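import Mathlib.NumberTheory.NumberField.Ideal.KummerDedekind
import Mathlib.NumberTheory.NumberField.Basic
import Mathlib.RingTheory.Discriminant
import Mathlib.RingTheory.Ideal.Int
import Mathlib.FieldTheory.Minpoly.IsIntegrallyClosed
import Mathlib.RingTheory.Polynomial.GaussLemma
import Mathlib.RingTheory.RamificationInertia.Basic
import Literature.NumberTheory.LFunctions.IdealNormCount
import Literature.NumberTheory.LFunctions.PrimeSumTauberian
import HarnessLib

/-!
# Degree-one primes: `∑_p (r_K(p) − 1)/p` converges, and roots of a polynomial modulo `p`

Topic `Literature/NumberTheory/LFunctions`. Everything in this file is PROVED (no `sorry`).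

Let `K` be a number field and `r_K(p) = c_K(p) = #{I ⊆ 𝓞 K : N(I) = p}` the number of prime
ideals of `𝓞 K` of norm `p`, i.e. of degree-one primes above `p` (`Literature.idealNormCount K p`).

* `exists_tendsto_sum_primesLE_idealNormCount_sub_one_div` — for every number field `K` the
  ordered series `∑_{p ≤ x} (r_K(p) − 1)/p` converges as `x → ∞`.
  Proof WITHOUT the prime ideal theorem or Mertens' theorem for `K`: the Abelian limit
  `Σ_p (r_K(p) − 1) p^{-s} → L` (`s → 1⁺`) comes from `log ζ_K(s) − log ζ(s)` and the class number
  formula residue (`IdealNormCount.lean`, on Mathlib's `NumberField.dedekindZeta`), and the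
  passage to ordered partial sums is the Hardy–Littlewood (Karamata) Tauberian theorem for prime
  sums with bounded coefficients (`PrimeSumTauberian.lean`, MV Thm. 5.11), whose Tauberian
  condition only needs Chebyshev's bound.
* `card_absNorm_eq_prime_eq_card_roots` — Dedekind–Kummer: for `α ∈ 𝓞 K` and a prime
  `p ∤ exponent α`, `r_K(p)` is the number of roots of `minpoly_ℤ α` in `ℤ/pℤ` (from Mathlib's
  `NumberField.Ideal.primesOverSpanEquivMonicFactorsMod` and residue degree = degree of the factor).
* `exponent_pos_of_powerBasis` — if `K = ℚ(α)` then `exponent α ≠ 0`: the discriminant of the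
  power basis lies in the conductor of `ℤ[α]` (Mathlib's `Algebra.discr_mul_isIntegral_mem_adjoin`),
  so the exceptional primes are finitely many.
* `exists_tendsto_sum_primesLE_rootCount_sub_one_div` — for `g ∈ ℤ[X]` monic irreducible with
  `ν_g(p) = #{n mod p : g(n) ≡ 0 (mod p)}`, the series `∑_{p ≤ x} (ν_g(p) − 1)/p` converges.
  This is Lemma 5.3.5 of Aletheia-Zomlefer–Fukshansky–Garcia (there deduced from Dedekind's
  criterion and the two Mertens theorems for `ℚ` and for `K`, the latter resting on Landau's prime
  ideal theorem) and step 2 of Bateman–Horn's convergence proof (Math. Comp. 16 (1962), p. 364: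
  "by an elementary result on the distribution of prime ideals"); it is the analytic leaf of the
  convergence of the Bateman–Horn constant (`Sieve/BatemanHornProofs.lean`).

## References

* R. Dedekind, *Über den Zusammenhang zwischen der Theorie der Ideale und der Theorie der
  höheren Congruenzen*, Abh. Kgl. Ges. Wiss. Göttingen 23 (1878), 1–23. [folklore]
* H. L. Montgomery, R. C. Vaughan, *Multiplicative Number Theory I*, Cambridge Stud. Adv. Math.
  97 (2007), Thm. 5.11. [cite: MontgomeryVaughan2007, Thm. 5.11]
* S. L. Aletheia-Zomlefer, L. Fukshansky, S. R. Garcia, *The Bateman–Horn conjecture: heuristics,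
  history, and applications*, Expo. Math. 38 (2020), §5.3, Lemma 5.3.5.
  [cite: AletheiaZomleferFukshanskyGarcia2020, §5.3 Lemma 5.3.5]
* P. T. Bateman, R. A. Horn, *A heuristic asymptotic formula concerning the distribution of
  prime numbers*, Math. Comp. 16 (1962), 363–367, p. 364. [cite: BatemanHornMathComp1962, p. 364]
-/

noncomputable section

open Polynomial NumberField UniqueFactorizationMonoid Finset Filter Topology

namespace Literature.NumberTheory.LFunctions

namespace DegreeOnePrimes

/-! ### Linear monic irreducible factors are the roots -/

/-- Over a field, the monic irreducible factors of degree one of `f ≠ 0` are the `X - a`, `a` a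
root of `f`. [folklore] -/
lemma filter_normalizedFactors_natDegree_eq_one {F : Type*} [Field F] [DecidableEq F]
    {f : F[X]} (hf : f ≠ 0) :
    (normalizedFactors f).toFinset.filter (fun Q => Q.natDegree = 1) =
      f.roots.toFinset.image (fun a => X - C a) := by
  ext Q
  simp only [Finset.mem_filter, Multiset.mem_toFinset, Finset.mem_image,
    Polynomial.mem_normalizedFactors_iff hf, mem_roots hf]
  constructor
  · rintro ⟨⟨_, hmonic, hdvd⟩, hdeg⟩
    have hQ : Q = X - C (-Q.coeff 0) := by
      rw [map_neg, sub_neg_eq_add]; exact hmonic.eq_X_add_C hdeg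
    refine ⟨-Q.coeff 0, ?_, hQ.symm⟩
    rw [← dvd_iff_isRoot, ← hQ]
    exact hdvd
  · rintro ⟨a, ha, rfl⟩
    exact ⟨⟨irreducible_X_sub_C a, monic_X_sub_C a, dvd_iff_isRoot.mpr ha⟩, natDegree_X_sub_C a⟩

/-- Auxiliary (proof-internal). [folklore] -/
lemma card_filter_normalizedFactors_natDegree_eq_one {F : Type*} [Field F] [DecidableEq F]
    {f : F[X]} (hf : f ≠ 0) :
    ((normalizedFactors f).toFinset.filter (fun Q => Q.natDegree = 1)).card =
      f.roots.toFinset.card := by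
  rw [filter_normalizedFactors_natDegree_eq_one hf, Finset.card_image_of_injective]
  intro a b hab
  exact C_injective (sub_right_injective hab)

/-- The number of roots of `g mod p` counted in `ZMod p` equals the number of residues
`n ∈ {0, …, p-1}` with `p ∣ g(n)`. [folklore] -/
lemma card_roots_toFinset_eq_card_range_filter (g : ℤ[X]) {p : ℕ} [Fact p.Prime]
    (h0 : g.map (Int.castRingHom (ZMod p)) ≠ 0) :
    (g.map (Int.castRingHom (ZMod p))).roots.toFinset.card =
      #((range p).filter fun n : ℕ => (p : ℤ) ∣ g.eval (n : ℤ)) := by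
  symm
  refine Finset.card_nbij' (fun n : ℕ ↦ (n : ZMod p)) (fun x : ZMod p ↦ x.val) ?_ ?_ ?_ ?_
  · intro n hn
    rw [mem_coe, mem_filter, mem_range] at hn
    dsimp only
    rw [mem_coe, Multiset.mem_toFinset, mem_roots h0, IsRoot.def, ← Int.cast_natCast,
      eval_intCast_map, eq_intCast, ZMod.intCast_zmod_eq_zero_iff_dvd]
    exact hn.2
  · intro x hx
    dsimp only
    rw [mem_coe, Multiset.mem_toFinset, mem_roots h0, IsRoot.def] at hx
    rw [mem_coe, mem_filter, mem_range]
    refine ⟨ZMod.val_lt x, ?_⟩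
    have h : ((g.eval ((x.val : ℕ) : ℤ) : ℤ) : ZMod p) = 0 := by
      rw [← hx, ← eq_intCast (Int.castRingHom (ZMod p)), ← eval_natCast_map,
        ZMod.natCast_zmod_val]
    exact (ZMod.intCast_zmod_eq_zero_iff_dvd _ _).mp h
  · intro n hn
    rw [mem_coe, mem_filter, mem_range] at hn
    dsimp only
    exact ZMod.val_natCast_of_lt hn.1
  · intro x _
    dsimp only
    exact ZMod.natCast_zmod_val x

variable {K : Type*} [Field K] [NumberField K]

/-! ### Ideals of prime norm are the primes of residue degree one -/

attribute [local instance] Int.ideal_span_isMaximal_of_prime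

/-- Auxiliary (proof-internal). [folklore] -/
lemma absNorm_span_natCast (p : ℕ) : Ideal.absNorm (Ideal.span {(p : ℤ)}) = p := by
  simp [Ideal.absNorm_span_singleton]

/-- An ideal of `𝓞 K` has prime norm `p` iff it is a prime ideal above `p` of residue degree
one. [folklore] -/
lemma absNorm_eq_prime_iff {p : ℕ} [hp : Fact p.Prime] (I : Ideal (𝓞 K)) :
    Ideal.absNorm I = p ↔
      I ∈ Ideal.primesOver (Ideal.span {(p : ℤ)}) (𝓞 K) ∧ I.inertiaDeg ℤ = 1 := by
  constructor
  · intro hI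
    have hprime : I.IsPrime := Ideal.isPrime_of_irreducible_absNorm
      (hI ▸ (Nat.irreducible_iff_nat_prime p).mpr hp.out)
    have hover : I.LiesOver (Ideal.span {(p : ℤ)}) := by
      rw [Ideal.liesOver_iff]
      refine Ideal.IsMaximal.eq_of_le inferInstance ?_ ?_
      · rw [Ideal.under_def]
        exact Ideal.comap_ne_top _ hprime.ne_top
      · rw [Ideal.span_le, Set.singleton_subset_iff, SetLike.mem_coe, Ideal.under_def,
          Ideal.mem_comap, map_natCast, ← hI]
        exact Ideal.absNorm_mem I
    refine ⟨⟨hprime, hover⟩, ?_⟩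
    have h := Ideal.absNorm_pow_inertiaDeg (Ideal.span {(p : ℤ)}) I
    rw [hI, absNorm_span_natCast] at h
    exact (Nat.pow_eq_self_iff hp.out.one_lt).mp h
  · rintro ⟨⟨hprime, hover⟩, hf⟩
    haveI := hprime
    haveI := hover
    have h := Ideal.absNorm_pow_inertiaDeg (Ideal.span {(p : ℤ)}) I
    rw [hf, pow_one, absNorm_span_natCast] at h
    exact h.symm

/-- **Dedekind–Kummer count of degree-one primes.** If `p ∤ exponent α` (the index of `ℤ[α]`
in `𝓞 K` away from `p`), the number of ideals of `𝓞 K` of norm `p` equals the number of roots of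
`minpoly α` modulo `p`. [folklore] -/
theorem card_absNorm_eq_prime_eq_card_roots {α : 𝓞 K} {p : ℕ} [Fact p.Prime]
    (hp : ¬ p ∣ RingOfIntegers.exponent α) :
    Nat.card {I : Ideal (𝓞 K) // Ideal.absNorm I = p} =
      ((minpoly ℤ α).map (Int.castRingHom (ZMod p))).roots.toFinset.card := by
  set e := NumberField.Ideal.primesOverSpanEquivMonicFactorsMod hp with he
  have e1 : {I : Ideal (𝓞 K) // Ideal.absNorm I = p} ≃
      {P : Ideal.primesOver (Ideal.span {(p : ℤ)}) (𝓞 K) // P.1.inertiaDeg ℤ = 1} :=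
    (Equiv.subtypeEquivRight (fun I => absNorm_eq_prime_iff I)).trans
      (Equiv.subtypeSubtypeEquivSubtypeInter
        (fun I => I ∈ Ideal.primesOver (Ideal.span {(p : ℤ)}) (𝓞 K))
        (fun I => I.inertiaDeg ℤ = 1)).symm
  have e2 : {P : Ideal.primesOver (Ideal.span {(p : ℤ)}) (𝓞 K) // P.1.inertiaDeg ℤ = 1} ≃
      {Q : RingOfIntegers.monicFactorsMod α p // Q.1.natDegree = 1} :=
    Equiv.subtypeEquiv e (fun P => by
      have h := NumberField.Ideal.inertiaDeg_primesOverSpanEquivMonicFactorsMod_symm_apply' hp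
        (e P).2
      rw [Subtype.coe_eta, ← he, Equiv.symm_apply_apply] at h
      rw [h])
  have e3 : {Q : RingOfIntegers.monicFactorsMod α p // Q.1.natDegree = 1} ≃
      {Q // Q ∈ (RingOfIntegers.monicFactorsMod α p).filter (fun Q => Q.natDegree = 1)} :=
    (Equiv.subtypeSubtypeEquivSubtypeInter
      (fun Q => Q ∈ RingOfIntegers.monicFactorsMod α p) (fun Q => Q.natDegree = 1)).trans
      (Equiv.subtypeEquivRight (fun Q => by rw [Finset.mem_filter]))
  rw [Nat.card_congr (e1.trans (e2.trans e3)), Nat.card_eq_finsetCard]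
  exact card_filter_normalizedFactors_natDegree_eq_one
    (map_monic_ne_zero (minpoly.monic α.isIntegral))

/-! ### The conductor of `ℤ[α]` is non-trivial when `K = ℚ(α)` -/

omit [NumberField K] in
/-- Auxiliary (proof-internal). [folklore] -/
lemma mem_adjoin_of_coe_mem_adjoin {α x : 𝓞 K}
    (h : (x : K) ∈ Algebra.adjoin ℤ {(α : K)}) : x ∈ Algebra.adjoin ℤ {α} := by
  set f : 𝓞 K →ₐ[ℤ] K := (algebraMap (𝓞 K) K).toIntAlgHom with hf
  have hfα : (α : K) = f α := rfl
  rw [hfα, ← AlgHom.map_adjoin_singleton, Subalgebra.mem_map] at h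
  obtain ⟨y, hy, hyx⟩ := h
  rwa [← RingOfIntegers.ext hyx]

/-- If `α ∈ 𝓞 K` generates `K` over `ℚ` (as the generator of a power basis), then the conductor
of `ℤ[α] ⊆ 𝓞 K` contains a positive integer — the discriminant of the power basis — so
`RingOfIntegers.exponent α ≠ 0` and the Dedekind–Kummer theorem applies at all but finitely many
primes. [folklore] -/
theorem exponent_pos_of_powerBasis (pb : PowerBasis ℚ K) {α : 𝓞 K} (hα : pb.gen = α) :
    0 < RingOfIntegers.exponent α := by
  classical
  have hint : IsIntegral ℤ pb.gen := hα ▸ RingOfIntegers.isIntegral_coe α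
  obtain ⟨D, hD⟩ : ∃ D : ℤ, algebraMap ℤ ℚ D = Algebra.discr ℚ pb.basis :=
    IsIntegrallyClosed.isIntegral_iff.mp
      (Algebra.discr_isIntegral ℚ (fun i => by rw [pb.coe_basis]; exact hint.pow _))
  have hD0 : D ≠ 0 := by
    rintro rfl
    exact Algebra.discr_not_zero_of_basis ℚ pb.basis (by rw [← hD, map_zero])
  have hmemD : ((D : ℤ) : 𝓞 K) ∈ conductor ℤ α := by
    rw [mem_conductor_iff]
    intro b
    have h := Algebra.discr_mul_isIntegral_mem_adjoin ℚ hint (RingOfIntegers.isIntegral_coe b)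
    rw [← hD, hα, Algebra.smul_def, ← IsScalarTower.algebraMap_apply ℤ ℚ K, eq_intCast] at h
    refine mem_adjoin_of_coe_mem_adjoin ?_
    show algebraMap (𝓞 K) K (↑D * b) ∈ Algebra.adjoin ℤ {(α : K)}
    rw [map_mul, map_intCast]
    exact h
  have hmem : ((D.natAbs : ℕ) : 𝓞 K) ∈ conductor ℤ α := by
    rw [← Int.cast_natCast]
    rcases Int.natAbs_eq D with h | h
    · rw [← h]; exact hmemD
    · rw [show ((D.natAbs : ℕ) : ℤ) = -D by omega, Int.cast_neg]
      exact (conductor ℤ α).neg_mem hmemD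
  rw [RingOfIntegers.exponent_eq_sInf]
  have hne : {d : ℕ | 0 < d ∧ (d : 𝓞 K) ∈ conductor ℤ α}.Nonempty :=
    ⟨D.natAbs, Int.natAbs_pos.mpr hD0, hmem⟩
  exact (Nat.sInf_mem hne).1

/-! ### The number field cut out by a monic irreducible `g ∈ ℤ[X]` -/

/-- Auxiliary (proof-internal). [folklore] -/
lemma irreducible_map_rat {g : ℤ[X]} (hg : g.Monic) (hirr : Irreducible g) :
    Irreducible (g.map (algebraMap ℤ ℚ)) :=
  hg.irreducible_iff_irreducible_map_fraction_map.mp hirr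

/-- For `g ∈ ℤ[X]` monic irreducible and `K = ℚ[X]/(g)` with root `α`: `α ∈ 𝓞 K`,
`minpoly_ℤ α = g`, and `exponent α ≠ 0`; hence for every prime `p ∤ exponent α` the number of
ideals of `𝓞 K` of norm `p` is the number of roots of `g` modulo `p`. [folklore] -/
theorem exists_card_absNorm_eq_prime_eq_rootCount {g : ℤ[X]} (hg : g.Monic) (hirr : Irreducible g)
    [Fact (Irreducible (g.map (algebraMap ℤ ℚ)))] :
    ∃ e : ℕ, 0 < e ∧ ∀ p : ℕ, p.Prime → ¬ p ∣ e →
      Nat.card {I : Ideal (𝓞 (AdjoinRoot (g.map (algebraMap ℤ ℚ)))) // Ideal.absNorm I = p} =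
        #((range p).filter fun n : ℕ => (p : ℤ) ∣ g.eval (n : ℤ)) := by
  set K := AdjoinRoot (g.map (algebraMap ℤ ℚ)) with hK
  have h0 : g.map (algebraMap ℤ ℚ) ≠ 0 := (Fact.out : Irreducible (g.map (algebraMap ℤ ℚ))).ne_zero
  have hroot : aeval (AdjoinRoot.root (g.map (algebraMap ℤ ℚ))) g = 0 := by
    rw [aeval_def, Subsingleton.elim (algebraMap ℤ K)
      ((AdjoinRoot.of (g.map (algebraMap ℤ ℚ))).comp (algebraMap ℤ ℚ)), ← eval₂_map]
    exact AdjoinRoot.eval₂_root _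
  have hint : IsIntegral ℤ (AdjoinRoot.root (g.map (algebraMap ℤ ℚ))) := ⟨g, hg, hroot⟩
  set α : 𝓞 K := ⟨AdjoinRoot.root (g.map (algebraMap ℤ ℚ)), hint⟩ with hαdef
  have hα : (α : K) = AdjoinRoot.root (g.map (algebraMap ℤ ℚ)) := rfl
  have hmin : minpoly ℤ α = g := by
    rw [← RingOfIntegers.minpoly_coe, hα]
    exact eq_of_monic_of_associated (minpoly.monic hint) hg
      ((minpoly.irreducible hint).associated_of_dvd hirr
        (minpoly.isIntegrallyClosed_dvd hint hroot))
  have hexp : 0 < RingOfIntegers.exponent α :=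
    exponent_pos_of_powerBasis (AdjoinRoot.powerBasis h0) (by rw [AdjoinRoot.powerBasis_gen, hα])
  refine ⟨RingOfIntegers.exponent α, hexp, fun p hp hpe => ?_⟩
  haveI := Fact.mk hp
  have hg0 : g.map (Int.castRingHom (ZMod p)) ≠ 0 := map_monic_ne_zero hg
  rw [card_absNorm_eq_prime_eq_card_roots hpe, hmin, card_roots_toFinset_eq_card_range_filter g hg0]

/-! ### `∑_{p ≤ x} (r_K(p) − 1)/p` converges (every number field) -/

/-- **Degree-one primes have average density one, in Mertens form, without the prime ideal
theorem.** For every number field `K` there is `L ∈ ℝ` with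
`∑_{p ≤ x} (r_K(p) − 1)/p → L` (`x → ∞`), where `r_K(p) = #{prime ideals of 𝓞 K of norm p}`.
(Classically: Mertens' theorem for `K`, Landau 1903, minus Mertens' theorem for `ℚ`; here from
`log ζ_K − log ζ` at `s = 1⁺` and the Hardy–Littlewood Tauberian theorem.) [folklore] -/
theorem exists_tendsto_sum_primesLE_idealNormCount_sub_one_div (K : Type*) [Field K]
    [NumberField K] :
    ∃ L : ℝ, Tendsto (fun x : ℕ => ∑ p ∈ Nat.primesLE x, ((idealNormCount K p : ℝ) - 1) / p)
      atTop (𝓝 L) := by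
  obtain ⟨L, hL⟩ := exists_tendsto_tsum_primes_idealNormCount_sub_one K
  refine ⟨L, PrimeSum.tendsto_sum_primesLE_div (a := fun p => (idealNormCount K p : ℝ) - 1)
    (B := (2 : ℝ) ^ Module.finrank ℚ K + 1) (fun p hp => ?_) hL⟩
  have h1 := idealNormCount_prime_le K hp
  have h0 : (0 : ℝ) ≤ idealNormCount K p := Nat.cast_nonneg _
  have h2 : (0 : ℝ) ≤ (2 : ℝ) ^ Module.finrank ℚ K := pow_nonneg zero_le_two _
  rw [abs_le]
  constructor <;> linarith

/-! ### The polynomial form: `∑_{p ≤ x} (ν_g(p) − 1)/p` converges for `g` monic irreducible -/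

/-- **Lemma 5.3.5 of Aletheia-Zomlefer–Fukshansky–Garcia; Bateman–Horn 1962, p. 364, step 2.**
Let `g ∈ ℤ[X]` be monic irreducible and `ν_g(p) = #{n ∈ {0,…,p−1} : p ∣ g(n)}` the number of
roots of `g` modulo `p`. Then `∑_{p ≤ x} (ν_g(p) − 1)/p` converges as `x → ∞`.
Proof: `ν_g(p) = r_K(p)` for `K = ℚ[X]/(g)` and all primes `p ∤ exponent α ≠ 0`
(`exists_card_absNorm_eq_prime_eq_rootCount`), so the partial sums differ from those of
`exists_tendsto_sum_primesLE_idealNormCount_sub_one_div` by an eventually constant amount.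
[cite: AletheiaZomleferFukshanskyGarcia2020, §5.3 Lemma 5.3.5] -/
theorem exists_tendsto_sum_primesLE_rootCount_sub_one_div {g : ℤ[X]} (hg : g.Monic)
    (hirr : Irreducible g) :
    ∃ L : ℝ, Tendsto (fun x : ℕ => ∑ p ∈ Nat.primesLE x,
      ((#((range p).filter fun n : ℕ => (p : ℤ) ∣ g.eval (n : ℤ)) : ℝ) - 1) / p) atTop (𝓝 L) := by
  haveI : Fact (Irreducible (g.map (algebraMap ℤ ℚ))) := ⟨irreducible_map_rat hg hirr⟩
  obtain ⟨e, he, hcount⟩ := exists_card_absNorm_eq_prime_eq_rootCount hg hirr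
  obtain ⟨L, hL⟩ :=
    exists_tendsto_sum_primesLE_idealNormCount_sub_one_div (AdjoinRoot (g.map (algebraMap ℤ ℚ)))
  -- the correction at the finitely many primes dividing the exponent `e`
  set δ : ℕ → ℝ := fun p =>
    ((#((range p).filter fun n : ℕ => (p : ℤ) ∣ g.eval (n : ℤ)) : ℝ) - 1) / p -
      ((idealNormCount (AdjoinRoot (g.map (algebraMap ℤ ℚ))) p : ℝ) - 1) / p with hδ
  have hδ0 : ∀ p : ℕ, p.Prime → ¬ p ∣ e → δ p = 0 := by
    intro p hp hpe
    simp only [hδ]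
    rw [idealNormCount_def, hcount p hp hpe, sub_self]
  have hconst : ∀ x : ℕ, e ≤ x → ∑ p ∈ Nat.primesLE x, δ p = ∑ p ∈ Nat.primesLE e, δ p := by
    intro x hx
    symm
    apply Finset.sum_subset
    · intro p hp
      rw [Nat.mem_primesLE] at hp ⊢
      exact ⟨hp.1.trans hx, hp.2⟩
    · intro p hpx hpe
      rw [Nat.mem_primesLE] at hpx hpe
      refine hδ0 p hpx.2 fun hdvd => hpe ⟨Nat.le_of_dvd he hdvd, hpx.2⟩
  have h2 : Tendsto (fun x : ℕ => ∑ p ∈ Nat.primesLE x, δ p) atTop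
      (𝓝 (∑ p ∈ Nat.primesLE e, δ p)) :=
    tendsto_const_nhds.congr' (by
      filter_upwards [eventually_ge_atTop e] with x hx
      exact (hconst x hx).symm)
  refine ⟨L + ∑ p ∈ Nat.primesLE e, δ p, (hL.add h2).congr' ?_⟩
  filter_upwards with x
  rw [← Finset.sum_add_distrib]
  refine Finset.sum_congr rfl fun p _ => ?_
  simp only [hδ]
  ring

end DegreeOnePrimes

end Literature.NumberTheory.LFunctions
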